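import Summits.Ventures.LatticeQCDFlow.Scaling.IdealStarAugmentation
import Summits.Ventures.LatticeQCDFlow.Scaling.HomLadderOneLevelModes
import Summits.Ventures.LatticeQCDFlow.Scaling.HomStarLazyLawFreeFloor

/-!
HONEST FRAMING: exact (Metropolis-corrected) sampling algorithms for lattice gauge theory; figures
of merit are autocorrelation/cost numbers at stated couplings and volumes; no continuum-physics
claim.

# HomLadderAugmentation — THE HOMOGENEOUS LADDER TAGGED WITH ITS STALE SET: THE SCHEME IS `t·T + h·R + (1−t−h)·I` (`T` THE ADJACENT TRANSPOSITION PROPOSAL, `R` THE HOT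
# REDRAW), THE AUGMENTED CHAIN ON `(configuration, stale set)` LUMPS ONTO THE SCHEME AND ONTO THE STALE-SET CHAIN OF FILE 6, AND ITS ONE-STEP ACTION ON LAWS IS EXPLICIT
# (lean-2 GEN-47, ours)

Venture-side (OURS).  Cell `lqcd-flow` (pub-lqcd), unit `pub-lqcd-lean-2-g47`, 2026-08-31.  Chapter AG, file 7 — the ceiling side, technical core (the ladder analogue of chapter L file 13,
`Scaling/IdealStarAugmentation`, whose fibre-sum lemmas it reuses).  THE HOMOGENEOUS LADDER in lazy form: `P = t·T + h·R + (1−t−h)·I` on `Fin (K+1) → S`, `T` = a uniformly chosen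
adjacent transposition of the levels (every swap accepted, file 2), `R = coordKernel M 0` with the exact hot sampler `M_0(u,·) = ν`, `0 ≤ t, h`, `t + h ≤ 1`; the weighted ladder of
files 2–3 is the case `h = (1−t)w_0` (`homLadder_lazyForm`).  The AUGMENTED CHAIN on `(Fin (K+1) → S) × Finset (Fin (K+1))` carries the STALE SET `D`: a swap `j` moves contents and
stale labels together (`z ↦ z∘σ_j`, `D ↦ σ_j(D)`), a redraw resamples `z_0 ∼ ν` and deletes `0` from `D`, the lazy part fixes both.  Hypothesis-equations `hPh`, `hP`, `hQ`; no definitions.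

* §1 **`homLadder_lazyForm`** (the weighted ladder with idle cold kernels is `t·T + (1−t)w_0·R + (1−t)(1−w_0)·I`); `image_levelSwap_levelSwap`, `eq_image_levelSwap_comm`.
* §2 `ladder_aug_isRowStochastic`; **`ladder_lump_fst`** (configuration marginal = the scheme), **`ladder_lump_snd`** (stale-set marginal = the chain `Q` of file 6);
  **`ladder_lawAt_fst`** ∕ **`ladder_lawAt_snd`** (from `δ_{(x, univ)}`: `δ_xPⁿ` and `δ_{univ}Qⁿ`).
* §3 **`ladder_stepLaw_apply`** — `(λP̂)(z',D') = Σ_j (t/K)·λ(z'∘σ_j, σ_j(D')) + h·Σ_{D : D∖{0} = D'} Σ_u λ(z'[0↦u], D)·M_0(u, z'_0) + (1−t−h)·λ(z',D')`.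

Reading (no numerics implied): bookkeeping for file 8 (freshness: clean positions are exactly `ν`-distributed, `‖δ_xPⁿ − ν^{⊗}‖_TV ≤ P(D_n ≠ ∅)`) and file 9 (the ceiling).  NOT CLAIMED here:
anything quantitative.  Literature grade (cell rule): OWN CONSTRUCTION (chapter L's, transported to the ladder); nothing cited; no new bib keys.
-/

noncomputable section

open Finset Function
open Literature.Probability.MarkovChains

namespace Summit.Ventures.LatticeQCDFlow.Scaling

variable {S : Type*} [Fintype S] [DecidableEq S] {K : ℕ} {ν : S → ℝ} {M : Fin (K + 1) → S → S → ℝ} {w : Fin (K + 1) → ℝ} {t h : ℝ}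

/-! ## §1 The lazy form of the weighted ladder; swaps of stale sets -/

/-- **THE WEIGHTED HOMOGENEOUS LADDER IN LAZY FORM:** with one law at every level and idle cold kernels,
`t·Sw + (1−t)·Upd_w = t·T + (1−t)w_0·coordKernel M 0 + (1−t)(1−w_0)·I` (`K ≥ 1`, `ν > 0`, `Σw = 1`). [ours] -/
theorem homLadder_lazyForm (hK : 1 ≤ K) (hν : ∀ v, 0 < ν v) (hidle : ∀ i : Fin K, ∀ u v, M i.succ u v = if v = u then 1 else 0)
    (hw1 : ∑ k, w k = 1) (x y : Fin (K + 1) → S) :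
    t * ptBareSwap (fun _ : Fin (K + 1) => ν) x y + (1 - t) * prodKernel w M x y
      = t * ptBareProposal x y + (1 - t) * w 0 * coordKernel M 0 x y + (1 - t - (1 - t) * w 0) * (if y = x then 1 else 0) := by
  rw [ptBareSwap_const_eq_proposal hK hν, prodKernel_idle_eq hidle hw1, prodKernel_hotOnly]
  ring

omit [Fintype S] [DecidableEq S] in
/-- `σ_j(σ_j(E)) = E` for stale sets. [ours] -/
theorem image_levelSwap_levelSwap (j : Fin K) (E : Finset (Fin (K + 1))) : (E.image (levelSwap j)).image (levelSwap j) = E := by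
  rw [Finset.image_image]
  convert Finset.image_id (s := E) using 2
  funext k
  simp [levelSwap, Equiv.swap_apply_self]

omit [Fintype S] [DecidableEq S] in
/-- `D' = σ_j(D) ↔ D = σ_j(D')`. [ours] -/
theorem eq_image_levelSwap_comm (j : Fin K) (D D' : Finset (Fin (K + 1))) : D' = D.image (levelSwap j) ↔ D = D'.image (levelSwap j) := by
  constructor
  · intro h; rw [h, image_levelSwap_levelSwap]
  · intro h; rw [h, image_levelSwap_levelSwap]

/-! ## §2 The augmented chain and its two lumpings -/

section Aug
variable {Ph : (Fin (K + 1) → S) × Finset (Fin (K + 1)) → (Fin (K + 1) → S) × Finset (Fin (K + 1)) → ℝ}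
  {P : (Fin (K + 1) → S) → (Fin (K + 1) → S) → ℝ} {Q : Finset (Fin (K + 1)) → Finset (Fin (K + 1)) → ℝ}

/-- The augmented chain is a transition matrix (`K ≥ 1`, `t, h ≥ 0`, `t + h ≤ 1`, `M_0` row-stochastic). [ours] -/
theorem ladder_aug_isRowStochastic (hK : 1 ≤ K) (ht0 : 0 ≤ t) (hh0 : 0 ≤ h) (hth : t + h ≤ 1) (hM : ∀ k, IsRowStochastic (M k))
    (hPh : ∀ p q, Ph p q = (∑ j : Fin K, t / K * (if q.1 = p.1 ∘ levelSwap j ∧ q.2 = p.2.image (levelSwap j) then (1 : ℝ) else 0))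
      + h * (coordKernel M 0 p.1 q.1 * (if q.2 = p.2.erase 0 then (1 : ℝ) else 0)) + (1 - t - h) * (if q.1 = p.1 ∧ q.2 = p.2 then (1 : ℝ) else 0)) :
    IsRowStochastic Ph := by
  have hKpos : (0 : ℝ) < K := Nat.cast_pos.mpr (by omega)
  refine ⟨fun p q => ?_, fun p => ?_⟩
  · rw [hPh]
    exact add_nonneg (add_nonneg (sum_nonneg fun j _ => mul_nonneg (by positivity) (by split_ifs <;> norm_num))
      (mul_nonneg hh0 (mul_nonneg (coordKernel_nonneg M (fun j u v => (hM j).1 u v) 0 _ _) (by split_ifs <;> norm_num))))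
      (mul_nonneg (by linarith) (by split_ifs <;> norm_num))
  · -- each of the three parts has unit mass
    have h1 : ∀ j : Fin K, ∑ q : (Fin (K + 1) → S) × Finset (Fin (K + 1)),
        (if q.1 = p.1 ∘ levelSwap j ∧ q.2 = p.2.image (levelSwap j) then (1 : ℝ) else 0) = 1 := by
      intro j
      rw [Finset.sum_eq_single (p.1 ∘ levelSwap j, p.2.image (levelSwap j))]
      · rw [if_pos ⟨rfl, rfl⟩]
      · intro q _ hq; rw [if_neg]; rintro ⟨h1, h2⟩; exact hq (Prod.ext h1 h2)
      · intro h; exact absurd (mem_univ _) h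
    have h2 : ∑ q : (Fin (K + 1) → S) × Finset (Fin (K + 1)), coordKernel M 0 p.1 q.1 * (if q.2 = p.2.erase 0 then (1 : ℝ) else 0) = 1 := by
      rw [Fintype.sum_prod_type]
      have : ∀ z : Fin (K + 1) → S, ∑ D : Finset (Fin (K + 1)),
          coordKernel M 0 p.1 (z, D).1 * (if (z, D).2 = p.2.erase 0 then (1 : ℝ) else 0) = coordKernel M 0 p.1 z := by
        intro z; dsimp only
        rw [← Finset.mul_sum, Finset.sum_ite_eq' univ (p.2.erase 0), if_pos (mem_univ _), mul_one]
      simp_rw [this]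
      exact sum_coordKernel_zero_eq_one hM p.1
    have h3 : ∑ q : (Fin (K + 1) → S) × Finset (Fin (K + 1)), (if q.1 = p.1 ∧ q.2 = p.2 then (1 : ℝ) else 0) = 1 := by
      rw [Finset.sum_eq_single p]
      · rw [if_pos ⟨rfl, rfl⟩]
      · intro q _ hq; rw [if_neg]; rintro ⟨h1, h2⟩; exact hq (Prod.ext h1 h2)
      · intro h; exact absurd (mem_univ _) h
    have hsplit : ∑ q, Ph p q = (∑ j : Fin K, t / K * ∑ q : (Fin (K + 1) → S) × Finset (Fin (K + 1)),
        (if q.1 = p.1 ∘ levelSwap j ∧ q.2 = p.2.image (levelSwap j) then (1 : ℝ) else 0))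
        + h * ∑ q : (Fin (K + 1) → S) × Finset (Fin (K + 1)), coordKernel M 0 p.1 q.1 * (if q.2 = p.2.erase 0 then (1 : ℝ) else 0)
        + (1 - t - h) * ∑ q : (Fin (K + 1) → S) × Finset (Fin (K + 1)), (if q.1 = p.1 ∧ q.2 = p.2 then (1 : ℝ) else 0) := by
      have hsw : ∑ j : Fin K, t / K * ∑ q : (Fin (K + 1) → S) × Finset (Fin (K + 1)),
          (if q.1 = p.1 ∘ levelSwap j ∧ q.2 = p.2.image (levelSwap j) then (1 : ℝ) else 0)
          = ∑ q : (Fin (K + 1) → S) × Finset (Fin (K + 1)), ∑ j : Fin K, t / K *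
            (if q.1 = p.1 ∘ levelSwap j ∧ q.2 = p.2.image (levelSwap j) then (1 : ℝ) else 0) := by
        rw [Finset.sum_comm]; simp_rw [Finset.mul_sum]
      rw [hsw, Finset.mul_sum, Finset.mul_sum, ← Finset.sum_add_distrib, ← Finset.sum_add_distrib]
      exact sum_congr rfl fun q _ => by rw [hPh]
    rw [hsplit]
    simp_rw [h1, h2, h3, mul_one, sum_const, card_univ, Fintype.card_fin, nsmul_eq_mul]
    field_simp; ring

/-- **FIRST LUMPING: the configuration marginal of the augmented chain is the lazy ladder `t·T + h·R + (1−t−h)·I`.** [ours] -/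
theorem ladder_lump_fst
    (hPh : ∀ p q, Ph p q = (∑ j : Fin K, t / K * (if q.1 = p.1 ∘ levelSwap j ∧ q.2 = p.2.image (levelSwap j) then (1 : ℝ) else 0))
      + h * (coordKernel M 0 p.1 q.1 * (if q.2 = p.2.erase 0 then (1 : ℝ) else 0)) + (1 - t - h) * (if q.1 = p.1 ∧ q.2 = p.2 then (1 : ℝ) else 0))
    (hP : ∀ x y, P x y = t * ptBareProposal x y + h * coordKernel M 0 x y + (1 - t - h) * (if y = x then 1 else 0))
    (p : (Fin (K + 1) → S) × Finset (Fin (K + 1))) (z' : Fin (K + 1) → S) :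
    P p.1 z' = ∑ q ∈ univ.filter (fun q : (Fin (K + 1) → S) × Finset (Fin (K + 1)) => q.1 = z'), Ph p q := by
  rw [sum_filter_prodFst_eq, hP]
  simp_rw [hPh, Finset.sum_add_distrib]
  congr 1; congr 1
  · unfold ptBareProposal
    rw [Finset.mul_sum, Finset.sum_comm]
    refine sum_congr rfl fun j _ => ?_
    rw [← Finset.mul_sum]
    by_cases hz : z' = p.1 ∘ levelSwap j
    · rw [if_pos hz]
      have : ∑ D' : Finset (Fin (K + 1)), (if z' = p.1 ∘ levelSwap j ∧ D' = p.2.image (levelSwap j) then (1 : ℝ) else 0) = 1 := by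
        simp_rw [hz, true_and]
        rw [Finset.sum_ite_eq' univ, if_pos (mem_univ _)]
      rw [this]; ring
    · rw [if_neg hz]
      have : ∑ D' : Finset (Fin (K + 1)), (if z' = p.1 ∘ levelSwap j ∧ D' = p.2.image (levelSwap j) then (1 : ℝ) else 0) = 0 :=
        sum_eq_zero fun D' _ => if_neg fun h' => hz h'.1
      rw [this]; ring
  · rw [← Finset.mul_sum]
    congr 1
    rw [← Finset.mul_sum, Finset.sum_ite_eq' univ (p.2.erase 0), if_pos (mem_univ _), mul_one]
  · rw [← Finset.mul_sum]
    congr 1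
    by_cases hz : z' = p.1
    · rw [if_pos hz]
      simp_rw [hz, true_and]
      rw [Finset.sum_ite_eq' univ, if_pos (mem_univ _)]
    · rw [if_neg hz]
      exact (sum_eq_zero fun D' _ => if_neg fun h' => hz h'.1).symm

/-- **SECOND LUMPING: the stale-set marginal of the augmented chain is the stale-set chain `Q` of file 6.** [ours] -/
theorem ladder_lump_snd (hM : ∀ k, IsRowStochastic (M k))
    (hPh : ∀ p q, Ph p q = (∑ j : Fin K, t / K * (if q.1 = p.1 ∘ levelSwap j ∧ q.2 = p.2.image (levelSwap j) then (1 : ℝ) else 0))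
      + h * (coordKernel M 0 p.1 q.1 * (if q.2 = p.2.erase 0 then (1 : ℝ) else 0)) + (1 - t - h) * (if q.1 = p.1 ∧ q.2 = p.2 then (1 : ℝ) else 0))
    (hQ : ∀ D D', Q D D' = (∑ j : Fin K, t / K * (if D' = D.image (levelSwap j) then (1 : ℝ) else 0))
      + h * (if D' = D.erase 0 then (1 : ℝ) else 0) + (1 - t - h) * (if D' = D then (1 : ℝ) else 0))
    (p : (Fin (K + 1) → S) × Finset (Fin (K + 1))) (D' : Finset (Fin (K + 1))) :
    Q p.2 D' = ∑ q ∈ univ.filter (fun q : (Fin (K + 1) → S) × Finset (Fin (K + 1)) => q.2 = D'), Ph p q := by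
  rw [sum_filter_prodSnd_eq, hQ]
  simp_rw [hPh, Finset.sum_add_distrib]
  congr 1; congr 1
  · rw [Finset.sum_comm]
    refine sum_congr rfl fun j _ => ?_
    rw [← Finset.mul_sum]
    congr 1
    by_cases hD : D' = p.2.image (levelSwap j)
    · rw [if_pos hD]
      simp_rw [hD, and_true]
      rw [Finset.sum_ite_eq' univ, if_pos (mem_univ _)]
    · rw [if_neg hD]
      exact (sum_eq_zero fun z _ => if_neg fun h' => hD h'.2).symm
  · rw [← Finset.mul_sum]
    congr 1
    calc (if D' = p.2.erase 0 then (1 : ℝ) else 0)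
        = (∑ z : Fin (K + 1) → S, coordKernel M 0 p.1 z) * (if D' = p.2.erase 0 then (1 : ℝ) else 0) := by
          rw [sum_coordKernel_zero_eq_one hM, one_mul]
      _ = ∑ z : Fin (K + 1) → S, coordKernel M 0 p.1 z * (if D' = p.2.erase 0 then (1 : ℝ) else 0) := Finset.sum_mul _ _ _
  · rw [← Finset.mul_sum]
    congr 1
    by_cases hD : D' = p.2
    · rw [if_pos hD]
      simp_rw [hD, and_true]
      rw [Finset.sum_ite_eq' univ, if_pos (mem_univ _)]
    · rw [if_neg hD]
      exact (sum_eq_zero fun z _ => if_neg fun h' => hD h'.2).symm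

/-- **From `δ_{(x, univ)}`: the configuration marginal of the augmented chain at time `n` is `δ_xPⁿ`.** [ours] -/
theorem ladder_lawAt_fst
    (hPh : ∀ p q, Ph p q = (∑ j : Fin K, t / K * (if q.1 = p.1 ∘ levelSwap j ∧ q.2 = p.2.image (levelSwap j) then (1 : ℝ) else 0))
      + h * (coordKernel M 0 p.1 q.1 * (if q.2 = p.2.erase 0 then (1 : ℝ) else 0)) + (1 - t - h) * (if q.1 = p.1 ∧ q.2 = p.2 then (1 : ℝ) else 0))
    (hP : ∀ x y, P x y = t * ptBareProposal x y + h * coordKernel M 0 x y + (1 - t - h) * (if y = x then 1 else 0))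
    (x : Fin (K + 1) → S) (n : ℕ) (z : Fin (K + 1) → S) :
    ∑ D : Finset (Fin (K + 1)), lawAt Ph (Pi.single (x, (univ : Finset (Fin (K + 1)))) 1) n (z, D) = lawAt P (Pi.single x 1) n z := by
  rw [← sum_filter_prodFst_eq (fun q => lawAt Ph (Pi.single (x, (univ : Finset (Fin (K + 1)))) 1) n q) z,
    LevinPeres2017_lemma_2_5_lawAt (P := Ph) (proj := Prod.fst) (Ps := P) (fun p z' => ladder_lump_fst hPh hP p z')]
  congr 1
  funext z'
  exact sum_filter_prodFst_single x univ z'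

/-- **From `δ_{(x, univ)}`: the stale-set marginal at time `n` is `δ_{univ}Qⁿ`, the same for every start `x`.** [ours] -/
theorem ladder_lawAt_snd (hM : ∀ k, IsRowStochastic (M k))
    (hPh : ∀ p q, Ph p q = (∑ j : Fin K, t / K * (if q.1 = p.1 ∘ levelSwap j ∧ q.2 = p.2.image (levelSwap j) then (1 : ℝ) else 0))
      + h * (coordKernel M 0 p.1 q.1 * (if q.2 = p.2.erase 0 then (1 : ℝ) else 0)) + (1 - t - h) * (if q.1 = p.1 ∧ q.2 = p.2 then (1 : ℝ) else 0))
    (hQ : ∀ D D', Q D D' = (∑ j : Fin K, t / K * (if D' = D.image (levelSwap j) then (1 : ℝ) else 0))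
      + h * (if D' = D.erase 0 then (1 : ℝ) else 0) + (1 - t - h) * (if D' = D then (1 : ℝ) else 0))
    (x : Fin (K + 1) → S) (n : ℕ) (D : Finset (Fin (K + 1))) :
    ∑ z : Fin (K + 1) → S, lawAt Ph (Pi.single (x, (univ : Finset (Fin (K + 1)))) 1) n (z, D) = lawAt Q (Pi.single (univ : Finset (Fin (K + 1))) 1) n D := by
  rw [← sum_filter_prodSnd_eq (fun q => lawAt Ph (Pi.single (x, (univ : Finset (Fin (K + 1)))) 1) n q) D,
    LevinPeres2017_lemma_2_5_lawAt (P := Ph) (proj := Prod.snd) (Ps := Q) (fun p D' => ladder_lump_snd hM hPh hQ p D')]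
  congr 1
  funext D'
  exact sum_filter_prodSnd_single x univ D'

/-! ## §3 The one-step action on laws -/

/-- **THE ONE-STEP ACTION OF THE AUGMENTED CHAIN ON A LAW `λ`:**
`(λP̂)(z',D') = Σ_j (t/K)·λ(z'∘σ_j, σ_j(D')) + h·Σ_{D : D∖{0} = D'} Σ_u λ(z'[0↦u], D)·M_0(u, z'_0) + (1−t−h)·λ(z',D')`. [ours] -/
theorem ladder_stepLaw_apply
    (hPh : ∀ p q, Ph p q = (∑ j : Fin K, t / K * (if q.1 = p.1 ∘ levelSwap j ∧ q.2 = p.2.image (levelSwap j) then (1 : ℝ) else 0))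
      + h * (coordKernel M 0 p.1 q.1 * (if q.2 = p.2.erase 0 then (1 : ℝ) else 0)) + (1 - t - h) * (if q.1 = p.1 ∧ q.2 = p.2 then (1 : ℝ) else 0))
    (lam : (Fin (K + 1) → S) × Finset (Fin (K + 1)) → ℝ) (z' : Fin (K + 1) → S) (D' : Finset (Fin (K + 1))) :
    stepLaw Ph lam (z', D')
      = (∑ j : Fin K, t / K * lam (z' ∘ levelSwap j, D'.image (levelSwap j)))
        + h * (∑ D ∈ univ.filter (fun D : Finset (Fin (K + 1)) => D.erase 0 = D'), ∑ u : S, lam (update z' 0 u, D) * M 0 u (z' 0))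
        + (1 - t - h) * lam (z', D') := by
  unfold stepLaw
  simp_rw [hPh, mul_add, Finset.sum_add_distrib]
  congr 1; congr 1
  · -- swap part: the unique predecessor of `(z', D')` under the pair `j`
    simp_rw [Finset.mul_sum]
    rw [Finset.sum_comm]
    refine sum_congr rfl fun j _ => ?_
    have hinvz : ∀ z : Fin (K + 1) → S, z' = z ∘ levelSwap j ↔ z = z' ∘ levelSwap j := fun z => eq_comp_levelSwap_comm j z z'
    have hinvD : ∀ D : Finset (Fin (K + 1)), D' = D.image (levelSwap j) ↔ D = D'.image (levelSwap j) := fun D => eq_image_levelSwap_comm j D D'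
    rw [Fintype.sum_prod_type]
    simp_rw [hinvz, hinvD]
    rw [Finset.sum_eq_single (z' ∘ levelSwap j)]
    · rw [Finset.sum_eq_single (D'.image (levelSwap j))]
      · rw [if_pos ⟨rfl, rfl⟩]; ring
      · intro D _ hD
        rw [if_neg (fun h' => hD h'.2)]; ring
      · intro h'; exact absurd (mem_univ _) h'
    · intro z _ hz
      exact sum_eq_zero fun D _ => by rw [if_neg (fun h' => hz h'.1)]; ring
    · intro h'; exact absurd (mem_univ _) h'
  · -- redraw part
    simp_rw [Finset.mul_sum]
    rw [Fintype.sum_prod_type, Finset.sum_comm, Finset.sum_filter]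
    refine sum_congr rfl fun D _ => ?_
    by_cases hD : D' = D.erase 0
    · simp_rw [if_pos hD, mul_one, if_pos hD.symm]
      have h' := sum_mul_coordKernel_zero (M := M) (fun z => lam (z, D)) z'
      calc ∑ z, lam (z, D) * (h * coordKernel M 0 z z')
          = h * ∑ z, lam (z, D) * coordKernel M 0 z z' := by rw [Finset.mul_sum]; exact sum_congr rfl fun z _ => by ring
        _ = h * ∑ u : S, lam (update z' 0 u, D) * M 0 u (z' 0) := by rw [h']
        _ = ∑ u : S, h * (lam (update z' 0 u, D) * M 0 u (z' 0)) := by rw [Finset.mul_sum]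
    · simp_rw [if_neg hD, mul_zero, if_neg (fun h' : D.erase 0 = D' => hD h'.symm)]
      simp
  · -- lazy part
    rw [Fintype.sum_prod_type]
    rw [Finset.sum_eq_single z']
    · rw [Finset.sum_eq_single D']
      · rw [if_pos ⟨rfl, rfl⟩]; ring
      · intro D _ hD; rw [if_neg (fun h' => hD h'.2.symm)]; ring
      · intro h'; exact absurd (mem_univ _) h'
    · intro z _ hz
      exact sum_eq_zero fun D _ => by rw [if_neg (fun h' => hz h'.1.symm)]; ring
    · intro h'; exact absurd (mem_univ _) h'

end Aug

end Summit.Ventures.LatticeQCDFlow.Scaling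

end
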